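import Summits.KontsevichZagierPeriods.KontsevichZagierPeriods.Theses.SymplecticScissors

/-!
# `CurvePeriodsTransfer` (stmt-KontsevichZagierPeriods-11129), line `standard-etale-models`:
# the stub `stub_etaleShift` (the étale Taylor shift)

For `g` real-analytic at `0` with algebraic Taylor coefficients, a root branch on `(0, ε)` of a plane
curve `G(s, y) = 0` with algebraic coefficients which is étale on `(0, ε)` (`∂_y G(s, g s) ≠ 0`), let
`m = ord₀ ∂_yG(s, g(s))`, `K = m + 1`, `T` = the Taylor polynomial of `g` of order `< K` and
`u = (g − T)/sᴷ` (the `K`-th iterated divided difference `dslope` of `g` at `0`, analytic at `0`).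
Then `G(s, T(s) + sᴷy) = sᵉ·G_K(s, y)` with `e = 2m + 1`, `sᴷ ∂_yG(s, T + sᴷy) = sᵉ ∂_yG_K(s, y)`,
`G_K(0, u 0) = 0` and `∂_yG_K(0, u 0) ≠ 0`: after the shift the branch ends at an ÉTALE point.

Proof (elementary): write the second-order Taylor expansion in `y` of `G` around the polynomial
centre `T(s)` with a POLYNOMIAL remainder, `G(s, a + h) = G(s, a) + h ∂_yG(s, a) + h² Q(s, a, h)`;
plugging `a = T(s)`, `h = sᴷ u(s)` into it and into the same expansion of `∂_yG` shows that the
polynomials `c₀(s) = G(s, T(s))` and `c₁(s) = ∂_yG(s, T(s))` are `O(s^{2m+1})`, resp. EXACTLY of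
order `m`, as `s → 0⁺`; a real polynomial which is `O(s^N)` at `0⁺` is divisible by `X^N`, so
`c₀ = X^{2m+1} b₀`, `c₁ = X^m b₁` and `G_K := b₀ + y b₁ + s y² Q(s, T(s), sᴷ y)` works. The second
identity is the `y`-derivative of the first. All polynomial algebra is done over the subring `𝔸 ⊂ ℝ`
of real algebraic numbers (`integralClosure ℚ ℝ`, written out in full below), so that every
coefficient produced is algebraic.

References: J. Bochnak, M. Coste, M.-F. Roy, *Real Algebraic Geometry* (1998), §8.1 (Nash germs,
étale description of algebraic branches); the order count is folklore (Newton–Puiseux practice).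
-/

noncomputable section

open scoped Topology
open Filter MvPolynomial

namespace Summit.KontsevichZagierPeriods.SymplecticScissors.CurvePeriodsTransfer

/-- Second-order Taylor expansion of a two-variable polynomial in its second variable around an
arbitrary centre, with a POLYNOMIAL remainder in the three variables `(s, a, h)`:
`G(s, a + h) = G(s, a) + h·∂₁G(s, a) + h²·Q(s, a, h)`. [folklore] -/
private theorem taylor₂ {A : Type*} [CommRing A] [Algebra A ℝ] (G : MvPolynomial (Fin 2) A) :
    ∃ Q : MvPolynomial (Fin 3) A, ∀ s a h : ℝ, aeval ![s, a + h] G =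
      aeval ![s, a] G + h * aeval ![s, a] (pderiv 1 G) + h ^ 2 * aeval ![s, a, h] Q := by
  induction G using MvPolynomial.induction_on with
  | C c => exact ⟨0, fun s a h => by simp⟩
  | add p q hp hq =>
    obtain ⟨Qp, hp⟩ := hp
    obtain ⟨Qq, hq⟩ := hq
    exact ⟨Qp + Qq, fun s a h => by rw [map_add, map_add, map_add, map_add, map_add, hp, hq]; ring⟩
  | mul_X p i hp =>
    obtain ⟨Qp, hp⟩ := hp
    have h10 : pderiv 1 (X 0 : MvPolynomial (Fin 2) A) = 0 := pderiv_X_of_ne (by decide)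
    revert i
    refine Fin.forall_fin_two.2 ⟨⟨Qp * X 0, fun s a h => ?_⟩,
      ⟨Qp * (X 1 + X 2) + rename Fin.castSucc (pderiv 1 p), fun s a h => ?_⟩⟩
    · simp only [map_mul, aeval_X, pderiv_mul, h10, hp, Fin.isValue,
        Matrix.cons_val_zero, mul_zero, add_zero]
      ring
    · have e : ((![s, a, h] : Fin 3 → ℝ) ∘ Fin.castSucc) = ![s, a] := by
        ext j; fin_cases j <;> rfl
      simp only [map_mul, map_add, aeval_X, pderiv_mul, pderiv_X_self, hp, aeval_rename, e,
        Fin.isValue, Matrix.cons_val_one, Matrix.cons_val_zero, Matrix.cons_val, mul_one]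
      ring

/-- The `y`-derivative of `y ↦ P(s, y)` for a two-variable polynomial `P` is `∂₁P(s, y)`. [folklore] -/
private theorem hasDerivAt_aeval₂ {A : Type*} [CommRing A] [Algebra A ℝ]
    (P : MvPolynomial (Fin 2) A) (s y : ℝ) :
    HasDerivAt (fun t => aeval ![s, t] P) (aeval ![s, y] (pderiv 1 P)) y := by
  induction P using MvPolynomial.induction_on with
  | C c => simpa [pderiv_C] using hasDerivAt_const y (algebraMap A ℝ c)
  | add p q hp hq => simpa using hp.fun_add hq
  | mul_X p i hp =>
    have h10 : pderiv 1 (X 0 : MvPolynomial (Fin 2) A) = 0 := pderiv_X_of_ne (by decide)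
    revert i
    refine Fin.forall_fin_two.2 ⟨?_, ?_⟩
    · have e1 : (fun t : ℝ => aeval ![s, t] (p * X 0)) = fun t => aeval ![s, t] p * s := by
        funext t; simp
      have e2 : aeval ![s, y] (pderiv 1 (p * X 0)) = aeval ![s, y] (pderiv 1 p) * s := by
        rw [pderiv_mul, h10, mul_zero, add_zero, map_mul, aeval_X]; rfl
      rw [e1, e2]
      exact hp.mul_const s
    · have e1 : (fun t : ℝ => aeval ![s, t] (p * X 1)) = fun t => aeval ![s, t] p * t := by
        funext t; simp
      have e2 : aeval ![s, y] (pderiv 1 (p * X 1)) =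
          aeval ![s, y] (pderiv 1 p) * y + aeval ![s, y] p * 1 := by
        rw [pderiv_mul, pderiv_X_self, map_add, map_mul, map_mul, map_one, aeval_X]; rfl
      rw [e1, e2]
      exact hp.fun_mul (hasDerivAt_id y)

/-- Taylor's formula with the iterated divided difference as remainder:
`g s = Σ_{n<k} aₙ sⁿ + sᵏ · ((swap dslope 0)^[k] g) s` for EVERY `s`, where `aₙ` are the power
series coefficients of `g` at `0`. [folklore] -/
private theorem taylor_dslope {g : ℝ → ℝ} {p : FormalMultilinearSeries ℝ ℝ ℝ}
    (hp : HasFPowerSeriesAt g p 0) (k : ℕ) (s : ℝ) :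
    g s = (∑ n ∈ Finset.range k, p.coeff n * s ^ n) +
      s ^ k * (Function.swap dslope 0)^[k] g s := by
  induction k with
  | zero => simp
  | succ k ih =>
    have hk : (Function.swap dslope 0)^[k] g 0 = p.coeff k := by
      rw [← (hp.has_fpower_series_iterate_dslope_fslope k).coeff_zero 1]
      change FormalMultilinearSeries.coeff _ 0 = _
      rw [FormalMultilinearSeries.coeff_iterate_fslope, zero_add]
    have hd := sub_smul_dslope ((Function.swap dslope 0)^[k] g) 0 s
    rw [sub_zero, smul_eq_mul, hk] at hd
    rw [ih, Finset.sum_range_succ, Function.iterate_succ_apply', pow_succ]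
    change _ = _ + s ^ k * s * dslope ((Function.swap dslope 0)^[k] g) 0 s
    linear_combination -(s ^ k * hd)

/-- Two functions continuous at `0` which agree on a right neighbourhood of `0` agree at `0`.
[folklore] -/
private theorem eq_of_eventuallyEq_nhdsGT {f₁ f₂ : ℝ → ℝ} (h₁ : ContinuousAt f₁ 0)
    (h₂ : ContinuousAt f₂ 0) (h : ∀ᶠ s in 𝓝[>] (0 : ℝ), f₁ s = f₂ s) : f₁ 0 = f₂ 0 :=
  tendsto_nhds_unique_of_eventuallyEq (h₁.tendsto.mono_left nhdsWithin_le_nhds)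
    (h₂.tendsto.mono_left nhdsWithin_le_nhds) h

/-- A polynomial (with coefficients in a subring `A ⊆ ℝ`) which is `O(s^N)` as `s → 0⁺` — precisely,
which equals `s^N · B(s)` on a right neighbourhood of `0` for some `B` continuous at `0` — is divisible
by `X^N`. [folklore] -/
private theorem X_pow_dvd_of_eventually {A : Type*} [CommRing A] [Algebra A ℝ]
    (hA : Function.Injective (algebraMap A ℝ)) :
    ∀ (N : ℕ) (c : Polynomial A) (B : ℝ → ℝ), ContinuousAt B 0 →
      (∀ᶠ s in 𝓝[>] (0 : ℝ), Polynomial.aeval s c = s ^ N * B s) → Polynomial.X ^ N ∣ c := by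
  intro N
  induction N with
  | zero => intro c B _ _; simp
  | succ N ih =>
    intro c B hB h
    have h0 : c.coeff 0 = 0 := by
      apply hA
      have := eq_of_eventuallyEq_nhdsGT (f₁ := fun s : ℝ => Polynomial.aeval s c)
        (f₂ := fun s => s ^ (N + 1) * B s) c.continuous_aeval.continuousAt
        ((continuousAt_id.pow _).mul hB) h
      simp only [ne_eq, Nat.add_eq_zero_iff, one_ne_zero, and_false, not_false_eq_true, zero_pow,
        zero_mul] at this
      rwa [Polynomial.aeval_def, Polynomial.eval₂_at_zero, ← map_zero (algebraMap A ℝ)] at this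
    obtain ⟨c', rfl⟩ := Polynomial.X_dvd_iff.2 h0
    rw [pow_succ']
    refine mul_dvd_mul_left _ (ih c' B hB ?_)
    filter_upwards [h, self_mem_nhdsWithin] with s hs hs0
    rw [map_mul, Polynomial.aeval_X] at hs
    exact mul_left_cancel₀ (ne_of_gt hs0) (by rw [hs]; ring)

/-- STUB `stub_etaleShift` of line `standard-etale-models` (crux stmt-KontsevichZagierPeriods-11129).
THE ÉTALE TAYLOR SHIFT: for `g` analytic at `0` with algebraic Taylor coefficients, a root branch on
`(0, ε)` of `G ∈ ℚ̄[s, y]` which is étale on `(0, ε)` (`∂_yG(s, g s) ≠ 0`), put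
`m = ord₀ ∂_yG(s, g(s))`, `K = m + 1`, `T = ` the Taylor polynomial of `g` of order `< K`,
`u = (g − T)/sᴷ`: then `G(s, T(s) + sᴷy) = sᵉ·G_K(s, y)` with `e = 2m + 1`, `G_K` a polynomial with
algebraic coefficients, `sᴷ ∂_yG(s, T + sᴷy) = sᵉ ∂_yG_K(s, y)`, `g = T + sᴷu` near `0`, `u` analytic at
`0` with `u 0 = g⁽ᴷ⁾(0)/K! ∈ ℚ̄`, `G_K(0, u 0) = 0` and `∂_yG_K(0, u 0) ≠ 0`: the shifted branch `u`
ends at an ÉTALE point `(0, u 0)` of `G_K = 0`. [cite: BochnakCosteRoy1998, §8.1] -/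
theorem stub_etaleShift : ∀ (g : ℝ → ℝ) (G : MvPolynomial (Fin 2) ℝ), AnalyticAt ℝ g 0 →
    (∀ n, IsAlgebraic ℚ (iteratedDeriv n g 0)) → (∀ d, IsAlgebraic ℚ (G.coeff d)) →
    (∀ᶠ s in 𝓝[>] (0 : ℝ), MvPolynomial.eval ![s, g s] G = 0) →
    (∀ᶠ s in 𝓝[>] (0 : ℝ), MvPolynomial.eval ![s, g s] (MvPolynomial.pderiv 1 G) ≠ 0) →
    ∃ (K e : ℕ) (T : Polynomial ℝ) (GK : MvPolynomial (Fin 2) ℝ) (u : ℝ → ℝ),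
      (∀ i, IsAlgebraic ℚ (T.coeff i)) ∧ (∀ d, IsAlgebraic ℚ (GK.coeff d)) ∧
      (∀ s y : ℝ, MvPolynomial.eval ![s, Polynomial.eval s T + s ^ K * y] G =
        s ^ e * MvPolynomial.eval ![s, y] GK) ∧
      (∀ s y : ℝ, s ^ K * MvPolynomial.eval ![s, Polynomial.eval s T + s ^ K * y]
          (MvPolynomial.pderiv 1 G) =
        s ^ e * MvPolynomial.eval ![s, y] (MvPolynomial.pderiv 1 GK)) ∧
      AnalyticAt ℝ u 0 ∧ (∀ᶠ s in 𝓝 (0 : ℝ), g s = Polynomial.eval s T + s ^ K * u s) ∧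
      IsAlgebraic ℚ (u 0) ∧ MvPolynomial.eval ![0, u 0] GK = 0 ∧
      MvPolynomial.eval ![0, u 0] (MvPolynomial.pderiv 1 GK) ≠ 0 := by
  intro g G₀ hg halg hG hroot hetale
  /- (0) Coefficients: the subring `𝔸` of real algebraic numbers; lift `G₀` to `G ∈ 𝔸[s, y]`. -/
  have memA : ∀ x : ℝ, IsAlgebraic ℚ x → x ∈ integralClosure ℚ ℝ := fun x hx => hx.isIntegral
  have algA : ∀ x : integralClosure ℚ ℝ, IsAlgebraic ℚ (x : ℝ) := fun x =>
    isAlgebraic_iff_isIntegral.2 x.2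
  have hAinj : Function.Injective (algebraMap (integralClosure ℚ ℝ) ℝ) := Subtype.val_injective
  obtain ⟨G, rfl⟩ : ∃ G : MvPolynomial (Fin 2) (integralClosure ℚ ℝ),
      map (algebraMap (integralClosure ℚ ℝ) ℝ) G = G₀ := by
    refine Set.mem_range.1 (mem_range_map_iff_coeffs_subset.2 fun c hc => ?_)
    obtain ⟨n, -, rfl⟩ := mem_coeffs_iff.1 hc
    exact ⟨⟨_, memA _ (hG n)⟩, rfl⟩
  simp only [pderiv_map, eval_map, ← aeval_def] at hroot hetale
  /- analyticity of polynomial expressions in analytic functions -/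
  have hid_an : AnalyticAt ℝ (fun s : ℝ => s) 0 := analyticAt_id
  have han : ∀ (P : MvPolynomial (Fin 2) (integralClosure ℚ ℝ)) {φ : ℝ → ℝ}, AnalyticAt ℝ φ 0 →
      AnalyticAt ℝ (fun s => aeval ![s, φ s] P) 0 := fun P φ hφ => by
    have hx : ∀ i, AnalyticAt ℝ (fun s => (![s, φ s] : Fin 2 → ℝ) i) 0 := by
      refine Fin.forall_fin_two.2 ⟨?_, ?_⟩
      · simp only [Matrix.cons_val_zero]; exact hid_an
      · simp only [Matrix.cons_val_one, Matrix.cons_val_fin_one]; exact hφ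
    have h := AnalyticAt.aeval_mvPolynomial hx P
    exact h
  have han3 : ∀ (P : MvPolynomial (Fin 3) (integralClosure ℚ ℝ)) {φ ψ : ℝ → ℝ}, AnalyticAt ℝ φ 0 →
      AnalyticAt ℝ ψ 0 → AnalyticAt ℝ (fun s => aeval ![s, φ s, ψ s] P) 0 := fun P φ ψ hφ hψ => by
    have hx : ∀ i, AnalyticAt ℝ (fun s => (![s, φ s, ψ s] : Fin 3 → ℝ) i) 0 := by
      intro i
      fin_cases i
      · simp only [Fin.zero_eta, Fin.isValue, Matrix.cons_val_zero]; exact hid_an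
      · simp only [Fin.mk_one, Fin.isValue, Matrix.cons_val_one, Matrix.cons_val_zero]; exact hφ
      · simp only [Fin.reduceFinMk, Matrix.cons_val]; exact hψ
    have h := AnalyticAt.aeval_mvPolynomial hx P
    exact h
  /- (1) The order `m` of `R s = ∂₁G(s, g s)` at `0`: `R = sᵐ·r`, `r 0 ≠ 0`. -/
  obtain ⟨m, r, hr_an, hr0, hr⟩ :=
    (han (pderiv 1 G) hg).exists_eventuallyEq_pow_smul_nonzero_iff.2 fun h0 => by
      obtain ⟨s, hs1, hs2⟩ := (hetale.and (h0.filter_mono nhdsWithin_le_nhds)).exists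
      exact hs1 hs2
  simp only [sub_zero, smul_eq_mul] at hr
  /- (2) Taylor data of `g`: `g = T + s^(m+1)·u` with `T ∈ 𝔸[s]`, `u` analytic at `0`. -/
  have hp := hg.hasFPowerSeriesAt
  have hcoef : ∀ n, iteratedDeriv n g 0 / (n.factorial : ℝ) ∈ integralClosure ℚ ℝ := fun n => by
    have : iteratedDeriv n g 0 / (n.factorial : ℝ) = ((n.factorial : ℚ)⁻¹) • iteratedDeriv n g 0 := by
      rw [Algebra.smul_def, map_inv₀, map_natCast, div_eq_inv_mul]
    rw [this]
    exact Subalgebra.smul_mem _ (memA _ (halg n)) _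
  obtain ⟨u, hu⟩ : ∃ u : ℝ → ℝ, u = (Function.swap dslope 0)^[m + 1] g := ⟨_, rfl⟩
  have hu_an : AnalyticAt ℝ u 0 := hu ▸ (hp.has_fpower_series_iterate_dslope_fslope (m + 1)).analyticAt
  have hu0 : u 0 = iteratedDeriv (m + 1) g 0 / ((m + 1).factorial : ℝ) := by
    rw [hu, ← (hp.has_fpower_series_iterate_dslope_fslope (m + 1)).coeff_zero 1]
    change FormalMultilinearSeries.coeff _ 0 = _
    rw [FormalMultilinearSeries.coeff_iterate_fslope, zero_add, FormalMultilinearSeries.coeff_ofScalars]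
  obtain ⟨T, hT⟩ : ∃ T : Polynomial (integralClosure ℚ ℝ), ∀ s : ℝ, Polynomial.aeval s T =
      ∑ n ∈ Finset.range (m + 1), iteratedDeriv n g 0 / (n.factorial : ℝ) * s ^ n :=
    ⟨∑ n ∈ Finset.range (m + 1), Polynomial.monomial n ⟨_, hcoef n⟩, fun s => by
      simp [Polynomial.aeval_monomial]⟩
  obtain ⟨τ, hτ⟩ : ∃ τ : ℝ → ℝ, ∀ s, τ s = Polynomial.aeval s T := ⟨_, fun _ => rfl⟩
  have hτ_an : AnalyticAt ℝ τ 0 := by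
    rw [show τ = fun s : ℝ => Polynomial.aeval s T from funext hτ]
    exact analyticAt_id.aeval_polynomial T
  have hgT : ∀ s, g s = τ s + s ^ (m + 1) * u s := fun s => by
    have := taylor_dslope hp (m + 1) s
    simp only [FormalMultilinearSeries.coeff_ofScalars] at this
    rw [hτ, hT, hu]
    exact this
  /- (3) Taylor expansions in `y` around `T(s)` and the order count. -/
  obtain ⟨Q, hQ⟩ := taylor₂ G
  obtain ⟨Q₂, hQ₂⟩ := taylor₂ (pderiv 1 G)
  obtain ⟨r₁, hr₁⟩ : ∃ r₁ : ℝ → ℝ, ∀ s, r₁ s = r s - s * u s * aeval ![s, τ s] (pderiv 1 (pderiv 1 G))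
      - s ^ (m + 2) * u s ^ 2 * aeval ![s, τ s, s ^ (m + 1) * u s] Q₂ := ⟨_, fun _ => rfl⟩
  have hr₁_an : AnalyticAt ℝ r₁ 0 := by
    rw [show r₁ = _ from funext hr₁]
    exact (hr_an.sub ((analyticAt_id.mul hu_an).mul (han _ hτ_an))).sub
      (((analyticAt_id.pow _).mul (hu_an.pow 2)).mul
        (han3 _ hτ_an ((analyticAt_id.pow _).mul hu_an)))
  have hr₁0 : r₁ 0 = r 0 := by simp [hr₁]
  -- `c₁(s) = ∂₁G(s, T s)` has order EXACTLY `m`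
  have hc₁ : ∀ᶠ s in 𝓝 (0 : ℝ), aeval ![s, τ s] (pderiv 1 G) = s ^ m * r₁ s := by
    filter_upwards [hr] with s hs
    have h2 := hQ₂ s (τ s) (s ^ (m + 1) * u s)
    rw [← hgT] at h2
    rw [hr₁]
    linear_combination hs - h2
  obtain ⟨B, hB⟩ : ∃ B : ℝ → ℝ, ∀ s, B s =
      -(u s * r₁ s) - s * u s ^ 2 * aeval ![s, τ s, s ^ (m + 1) * u s] Q := ⟨_, fun _ => rfl⟩
  have hB_an : AnalyticAt ℝ B 0 := by
    rw [show B = _ from funext hB]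
    exact (hu_an.mul hr₁_an).neg.sub ((analyticAt_id.mul (hu_an.pow 2)).mul
      (han3 _ hτ_an ((analyticAt_id.pow _).mul hu_an)))
  -- `c₀(s) = G(s, T s)` is `O(s^(2m+1))`
  have hc₀ : ∀ᶠ s in 𝓝[>] (0 : ℝ), aeval ![s, τ s] G = s ^ (2 * m + 1) * B s := by
    filter_upwards [hroot, hc₁.filter_mono nhdsWithin_le_nhds] with s h0 h1
    have h2 := hQ s (τ s) (s ^ (m + 1) * u s)
    rw [← hgT, h0] at h2
    rw [hB]
    linear_combination -h2 - s ^ (m + 1) * u s * h1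
  /- (4) The polynomials `c₀ = X^(2m+1)·b₀`, `c₁ = X^m·b₁` in `𝔸[X]`, and `G_K`. -/
  have hev : ∀ (P : MvPolynomial (Fin 2) (integralClosure ℚ ℝ)) (s : ℝ),
      Polynomial.aeval s (aeval ![Polynomial.X, T] P) = aeval ![s, τ s] P := fun P s => by
    rw [comp_aeval_apply]
    congr 1
    ext i
    fin_cases i <;> simp [hτ]
  obtain ⟨b₀, hb₀⟩ : Polynomial.X ^ (2 * m + 1) ∣ aeval ![Polynomial.X, T] G :=
    X_pow_dvd_of_eventually hAinj _ _ B hB_an.continuousAt (hc₀.mono fun s hs => by rwa [hev])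
  obtain ⟨b₁, hb₁⟩ : Polynomial.X ^ m ∣ aeval ![Polynomial.X, T] (pderiv 1 G) :=
    X_pow_dvd_of_eventually hAinj _ _ r₁ hr₁_an.continuousAt
      ((hc₁.filter_mono nhdsWithin_le_nhds).mono fun s hs => by rwa [hev])
  have hC₀ : ∀ s : ℝ, aeval ![s, τ s] G = s ^ (2 * m + 1) * Polynomial.aeval s b₀ := fun s => by
    rw [← hev, hb₀, map_mul, map_pow, Polynomial.aeval_X]
  have hC₁ : ∀ s : ℝ, aeval ![s, τ s] (pderiv 1 G) = s ^ m * Polynomial.aeval s b₁ := fun s => by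
    rw [← hev, hb₁, map_mul, map_pow, Polynomial.aeval_X]
  obtain ⟨GK, hGK⟩ : ∃ GK : MvPolynomial (Fin 2) (integralClosure ℚ ℝ), ∀ s y : ℝ,
      aeval ![s, y] GK = Polynomial.aeval s b₀ + y * Polynomial.aeval s b₁ +
        s * y ^ 2 * aeval ![s, τ s, s ^ (m + 1) * y] Q := by
    obtain ⟨F, hF⟩ : ∃ F : Fin 3 → MvPolynomial (Fin 2) (integralClosure ℚ ℝ), ∀ s y : ℝ,
        (fun i => aeval ![s, y] (F i)) = ![s, τ s, s ^ (m + 1) * y] :=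
      ⟨![X 0, Polynomial.aeval (X 0) T, X 0 ^ (m + 1) * X 1], fun s y => by
        ext i; fin_cases i <;> simp [← Polynomial.aeval_algHom_apply, hτ]⟩
    refine ⟨Polynomial.aeval (X 0) b₀ + X 1 * Polynomial.aeval (X 0) b₁ + X 0 * X 1 ^ 2 * bind₁ F Q,
      fun s y => ?_⟩
    rw [← hF s y]
    simp only [map_add, map_mul, map_pow, aeval_X, aeval_bind₁, ← Polynomial.aeval_algHom_apply,
      Matrix.cons_val_zero, Matrix.cons_val_one, Matrix.cons_val_fin_one]
  /- (5) The two identities. -/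
  have hid3 : ∀ s y : ℝ, aeval ![s, τ s + s ^ (m + 1) * y] G = s ^ (2 * m + 1) * aeval ![s, y] GK := by
    intro s y
    rw [hQ, hGK, hC₀, hC₁]
    ring
  have hid4 : ∀ s y : ℝ, s ^ (m + 1) * aeval ![s, τ s + s ^ (m + 1) * y] (pderiv 1 G) =
      s ^ (2 * m + 1) * aeval ![s, y] (pderiv 1 GK) := by
    intro s y
    have h1 : HasDerivAt (fun y => aeval ![s, τ s + s ^ (m + 1) * y] G)
        (aeval ![s, τ s + s ^ (m + 1) * y] (pderiv 1 G) * (s ^ (m + 1))) y := by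
      have hin : HasDerivAt (fun y => τ s + s ^ (m + 1) * y) (s ^ (m + 1)) y := by
        simpa using ((hasDerivAt_id y).const_mul (s ^ (m + 1))).const_add (τ s)
      exact (hasDerivAt_aeval₂ G s _).comp y hin
    have h2 : HasDerivAt (fun y => aeval ![s, τ s + s ^ (m + 1) * y] G)
        (s ^ (2 * m + 1) * aeval ![s, y] (pderiv 1 GK)) y := by
      rw [show (fun y => aeval ![s, τ s + s ^ (m + 1) * y] G) =
          fun y => s ^ (2 * m + 1) * aeval ![s, y] GK from funext (hid3 s)]
      exact (hasDerivAt_aeval₂ GK s y).const_mul _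
    linear_combination h1.unique h2
  /- (6) The end point `(0, u 0)` is an étale point of `G_K = 0`. -/
  have hGK0 : aeval ![0, u 0] GK = 0 := by
    refine eq_of_eventuallyEq_nhdsGT (f₁ := fun s => aeval ![s, u s] GK) (f₂ := fun _ => 0)
      (han GK hu_an).continuousAt continuousAt_const ?_
    filter_upwards [hroot, self_mem_nhdsWithin] with s h0 hs
    have h3 := hid3 s (u s)
    rw [← hgT, h0] at h3
    exact (mul_eq_zero.1 h3.symm).resolve_left (pow_ne_zero _ (ne_of_gt hs))
  have hGK1 : aeval ![0, u 0] (pderiv 1 GK) ≠ 0 := by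
    have := eq_of_eventuallyEq_nhdsGT (f₁ := fun s => aeval ![s, u s] (pderiv 1 GK)) (f₂ := r)
      (han (pderiv 1 GK) hu_an).continuousAt hr_an.continuousAt ?_
    · simpa [this] using hr0
    filter_upwards [hr.filter_mono nhdsWithin_le_nhds, self_mem_nhdsWithin] with s h0 hs
    have h4 := hid4 s (u s)
    rw [← hgT, h0] at h4
    refine mul_left_cancel₀ (pow_ne_zero (2 * m + 1) (ne_of_gt hs)) ?_
    linear_combination -h4
  /- (7) Assembly, mapping everything from `𝔸` to `ℝ`. -/
  refine ⟨m + 1, 2 * m + 1, T.map (algebraMap (integralClosure ℚ ℝ) ℝ),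
    map (algebraMap (integralClosure ℚ ℝ) ℝ) GK, u, fun i => ?_, fun d => ?_, fun s y => ?_,
    fun s y => ?_, hu_an, Filter.Eventually.of_forall fun s => ?_, ?_, ?_, ?_⟩
  · rw [Polynomial.coeff_map, Subalgebra.algebraMap_apply]; exact algA _
  · rw [coeff_map, Subalgebra.algebraMap_apply]; exact algA _
  · rw [eval_map, eval_map, ← aeval_def, ← aeval_def, Polynomial.eval_map, ← Polynomial.aeval_def,
      ← hτ]
    exact hid3 s y
  · rw [pderiv_map, pderiv_map, eval_map, eval_map, ← aeval_def, ← aeval_def, Polynomial.eval_map,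
      ← Polynomial.aeval_def, ← hτ]
    exact hid4 s y
  · rw [Polynomial.eval_map, ← Polynomial.aeval_def, ← hτ]; exact hgT s
  · rw [hu0]; exact algA ⟨_, hcoef _⟩
  · rw [eval_map, ← aeval_def]; exact hGK0
  · rw [pderiv_map, eval_map, ← aeval_def]; exact hGK1

end Summit.KontsevichZagierPeriods.SymplecticScissors.CurvePeriodsTransfer

end
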